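import Literature.NumberTheory.Automorphic.JacquetLanglandsSurjectiveOfTraceComparison
import Literature.NumberTheory.Automorphic.IntegratedOperatorStar
import HarnessLib

/-!
# The comparison datum of `jacquetLanglands_transfer_surjective_of_hilbertSchmidtComparison` from a
# matched `*`-algebra of test functions with a Hilbert–Schmidt trace inequality
(Gelbart, *Automorphic forms on adele groups* (1975), §10, (10.10)–(10.15) and Lemma 10.6;
Jacquet–Langlands, LNM 114 (1970), §16: "we combine Lemma 16.1.1 with the Selberg trace formula")

Topic `NumberTheory/Automorphic`; theorems only (no definition, no named fact, no instance). The
reduction `jacquetLanglands_transfer_surjective_of_hilbertSchmidtComparison`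
(`JacquetLanglandsSurjectiveOfTraceComparison`) asks, for each cuspidal `π`, for a `*`-closed,
product-closed `ℂ`-subspace `B` of operator pairs on `L²(D_𝔸ˣ ⧸ ℝ_{>0} Dˣ) × π`, stable under left
multiplication by the matched local group elements, with a Hilbert–Schmidt inequality along `B` and
one pair non-zero on `π`. In the proof by the trace formula such a `B` is the image of a **matched
`*`-algebra of test functions** `𝒜 ∋ (Φ', Φ)` under `(Φ', Φ) ↦ (R'(Φ'), R(Φ)|_π)`, and the
Hilbert–Schmidt inequality on `B` is the comparison of trace formulas
`‖R'(Φ')‖²_HS = (geometric side)' = (geometric side) = ‖R₀(Φ)‖²_HS ≥ ‖R(Φ)|_π‖²_HS`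
((10.14) = (10.15), (10.13)). This file performs that passage from test functions to operators once
and for all, for two arbitrary unitary strongly continuous representations `π₁` of `G₁`, `π₂` of
`G₂` (the regular representations of `D_𝔸ˣ` and `GL₂(𝔸_K)`), a closed subrepresentation
`σ ≤ π₂` (the cuspidal `π`) and a family of pairs of homomorphisms `φ₁ᵥ : L_v → G₁`,
`φ₂ᵥ : L_v → G₂` (the local groups `GL₂(K_v)`, `v ∉ Ram(D)`, embedded on both sides):

* `ContRepresentation.ClosedSubrep.integratedOperatorRestrict_add/_smul/_comp`,
  `…adjoint_integratedOperatorRestrict`, `…toContRep_comp_integratedOperatorRestrict` — the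
  compression `Π(f)|_σ` of the integrated operator to a closed invariant subspace is again a
  `*`-representation of `C_c(G)` compatible with translations (from `IntegratedOperatorStar`);
  `…tsum_nnnorm_sq_integratedOperatorRestrict_le` — `‖Π(f)|_σ‖_HS ≤ ‖Π(f)‖_HS`
  (`tsum_nnnorm_sq_apply_coe_le`).
* `exists_comparisonDatum_of_testAlgebra` — **the datum**: given a `ℂ`-subspace
  `𝒜 ≤ C_c(G₁) × C_c(G₂)` closed under the componentwise involution `f ↦ f^*`, convolution and
  left translation by the pairs `(φ₁ᵥ l, φ₂ᵥ l)`, Hilbert bases `(b_i)` of `H₁`, `(e_l)` of `H₂`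
  with `Σ_l ‖π₂(Φ) e_l‖² ≤ Σ_i ‖π₁(Φ') b_i‖² < ∞` for all `(Φ', Φ) ∈ 𝒜`, and one `(Φ', Φ) ∈ 𝒜`
  with `π₂(Φ)|_σ ≠ 0`, the subspace `B = {(π₁(Φ'), π₂(Φ)|_σ) : (Φ', Φ) ∈ 𝒜}` has all the
  properties required by `jacquetLanglands_transfer_surjective_of_hilbertSchmidtComparison`
  (with any Hilbert basis of `σ`).

So, for the surjectivity half of Jacquet–Langlands, the analytic input is reduced to: a matched
`*`-algebra `𝒜` of test-function pairs, the trace-formula inequality `‖R(Φ)‖_HS ≤ ‖R'(Φ')‖_HS` on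
`𝒜` (an equality in the sources), and the non-vanishing of some `R(Φ)|_π`, `Φ ∈ pr₂ 𝒜`
(`SupercuspidalPlaceNonvanishing`).

## References

* S. Gelbart, *Automorphic forms on adele groups*, Ann. of Math. Studies 83 (1975), §10
  (10.10)–(10.15), Lemma 10.6 [Gelbart1975].
* H. Jacquet, R. P. Langlands, *Automorphic forms on `GL(2)`*, LNM 114 (1970), §16, pp. 496–503
  [JacquetLanglands1970].
* A. Deitmar, S. Echterhoff, *Principles of harmonic analysis*, 2nd ed. (2014), Prop. 6.2.1
  [DeitmarEchterhoff2014].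
-/

noncomputable section

open scoped InnerProductSpace ComplexConjugate NNReal ENNReal
open MeasureTheory Filter Topology CompactlySupported
open Literature.NumberTheory.Automorphic

/-! ### The compression `Π(f)|_σ` is a `*`-representation of `C_c(G)` -/

namespace ContRepresentation

namespace ClosedSubrep

variable {G H : Type*} [Group G] [TopologicalSpace G] [MeasurableSpace G] [BorelSpace G]
  [NormedAddCommGroup H] [InnerProductSpace ℂ H] [CompleteSpace H]
  {π : ContRepresentation ℂ G H}

/-- `Π(f₁ + f₂)|_σ = Π(f₁)|_σ + Π(f₂)|_σ`. [folklore] -/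
theorem integratedOperatorRestrict_add (hu : π.IsUnitary) (hc : π.IsStronglyContinuous)
    (η : Measure G) [IsFiniteMeasureOnCompacts η] (W : ClosedSubrep π) (f₁ f₂ : C_c(G, ℂ)) :
    W.integratedOperatorRestrict hu hc η (f₁ + f₂) =
      W.integratedOperatorRestrict hu hc η f₁ + W.integratedOperatorRestrict hu hc η f₂ := by
  refine ContinuousLinearMap.ext fun w => Subtype.ext ?_
  rw [add_apply, Submodule.coe_add, coe_integratedOperatorRestrict_apply,
    coe_integratedOperatorRestrict_apply, coe_integratedOperatorRestrict_apply,
    integratedOperator_add, add_apply]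

/-- `Π(c f)|_σ = c Π(f)|_σ`. [folklore] -/
theorem integratedOperatorRestrict_smul (hu : π.IsUnitary) (hc : π.IsStronglyContinuous)
    (η : Measure G) [IsFiniteMeasureOnCompacts η] (W : ClosedSubrep π) (c : ℂ) (f : C_c(G, ℂ)) :
    W.integratedOperatorRestrict hu hc η (c • f) = c • W.integratedOperatorRestrict hu hc η f := by
  refine ContinuousLinearMap.ext fun w => Subtype.ext ?_
  rw [smul_apply, Submodule.coe_smul, coe_integratedOperatorRestrict_apply,
    coe_integratedOperatorRestrict_apply, integratedOperator_smul, smul_apply]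

/-- **`Π(f₁)|_σ ∘ Π(f₂)|_σ = Π(f₁ ⋆ f₂)|_σ`** (`integratedOperator_comp_integratedOperator`).
[cite: DeitmarEchterhoff2014, Prop. 6.2.1] -/
theorem integratedOperatorRestrict_comp [IsTopologicalGroup G] [SecondCountableTopology G]
    (hu : π.IsUnitary) (hc : π.IsStronglyContinuous)
    (η : Measure G) [IsFiniteMeasureOnCompacts η] [SFinite η] [η.IsMulLeftInvariant]
    (W : ClosedSubrep π) (f₁ f₂ F : C_c(G, ℂ)) (hF : ∀ x, F x = mulConv η (⇑f₁) (⇑f₂) x) :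
    W.integratedOperatorRestrict hu hc η f₁ ∘L W.integratedOperatorRestrict hu hc η f₂ =
      W.integratedOperatorRestrict hu hc η F := by
  refine ContinuousLinearMap.ext fun w => Subtype.ext ?_
  have h := congrArg (fun T : H →L[ℂ] H => T (w : H))
    (integratedOperator_comp_integratedOperator hu hc η f₁ f₂ F hF)
  simp only [ContinuousLinearMap.comp_apply] at h
  rw [ContinuousLinearMap.comp_apply, coe_integratedOperatorRestrict_apply,
    coe_integratedOperatorRestrict_apply, coe_integratedOperatorRestrict_apply]
  exact h

/-- **`(Π(f)|_σ)^* = Π(f^*)|_σ`** (`adjoint_integratedOperator`; the inner product of `σ` is that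
of `H`). [cite: DeitmarEchterhoff2014, Prop. 6.2.1] -/
theorem adjoint_integratedOperatorRestrict [IsTopologicalGroup G] [MeasurableInv G]
    (hu : π.IsUnitary) (hc : π.IsStronglyContinuous)
    (η : Measure G) [IsFiniteMeasureOnCompacts η] [η.IsInvInvariant]
    (W : ClosedSubrep π) (f F : C_c(G, ℂ)) (hF : ∀ x, F x = mulStar (⇑f) x) :
    ContinuousLinearMap.adjoint (W.integratedOperatorRestrict hu hc η f) =
      W.integratedOperatorRestrict hu hc η F := by
  haveI : CompleteSpace W.toSubmodule := W.isClosed'.completeSpace_coe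
  symm
  rw [ContinuousLinearMap.eq_adjoint_iff]
  intro v w
  rw [Submodule.coe_inner, Submodule.coe_inner, coe_integratedOperatorRestrict_apply,
    coe_integratedOperatorRestrict_apply, ← adjoint_integratedOperator hu hc η f F hF,
    ContinuousLinearMap.adjoint_inner_left]

/-- **`σ(g) ∘ Π(f)|_σ = Π(λ_g f)|_σ`** (`apply_comp_integratedOperator`). [folklore] -/
theorem toContRep_comp_integratedOperatorRestrict [MeasurableMul G]
    (hu : π.IsUnitary) (hc : π.IsStronglyContinuous)
    (η : Measure G) [IsFiniteMeasureOnCompacts η] [η.IsMulLeftInvariant]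
    (W : ClosedSubrep π) (g : G) (f F : C_c(G, ℂ)) (hF : ∀ x, F x = f (g⁻¹ * x)) :
    W.toContRep g ∘L W.integratedOperatorRestrict hu hc η f =
      W.integratedOperatorRestrict hu hc η F := by
  refine ContinuousLinearMap.ext fun w => Subtype.ext ?_
  have h := congrArg (fun T : H →L[ℂ] H => T (w : H)) (apply_comp_integratedOperator hu hc η g f F hF)
  simp only [ContinuousLinearMap.comp_apply] at h
  rw [ContinuousLinearMap.comp_apply, coe_toContRep_apply, coe_integratedOperatorRestrict_apply,
    coe_integratedOperatorRestrict_apply]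
  exact h

/-- **`‖Π(f)|_σ‖_HS ≤ ‖Π(f)‖_HS`**: for Hilbert bases `(c_j)` of `σ` and `(e_l)` of `H`,
`Σ_j ‖Π(f)|_σ c_j‖² ≤ Σ_l ‖Π(f) e_l‖²` (`tsum_nnnorm_sq_apply_coe_le`). [folklore] -/
theorem tsum_nnnorm_sq_integratedOperatorRestrict_le (hu : π.IsUnitary)
    (hc : π.IsStronglyContinuous) (η : Measure G) [IsFiniteMeasureOnCompacts η]
    (W : ClosedSubrep π) {ι ι' : Type*} (c : HilbertBasis ι' ℂ W.toSubmodule)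
    (e : HilbertBasis ι ℂ H) (f : C_c(G, ℂ)) :
    ∑' j, (‖W.integratedOperatorRestrict hu hc η f (c j)‖₊ : ℝ≥0∞) ^ 2 ≤
      ∑' l, (‖π.integratedOperator hu hc η f (e l)‖₊ : ℝ≥0∞) ^ 2 := by
  haveI : CompleteSpace W.toSubmodule := W.isClosed'.completeSpace_coe
  have h : ∀ j, ‖W.integratedOperatorRestrict hu hc η f (c j)‖₊ =
      ‖π.integratedOperator hu hc η f (c j : H)‖₊ := fun j => rfl
  simp_rw [h]
  exact tsum_nnnorm_sq_apply_coe_le W.toSubmodule c e (π.integratedOperator hu hc η f)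

end ClosedSubrep

end ContRepresentation

/-! ### The comparison datum from a matched `*`-algebra of test functions -/

namespace Literature.NumberTheory.Automorphic

open ContRepresentation

section Datum

variable {G₁ G₂ H₁ H₂ : Type*}
  [Group G₁] [TopologicalSpace G₁] [IsTopologicalGroup G₁] [MeasurableSpace G₁] [BorelSpace G₁]
  [SecondCountableTopology G₁]
  [Group G₂] [TopologicalSpace G₂] [IsTopologicalGroup G₂] [MeasurableSpace G₂] [BorelSpace G₂]
  [SecondCountableTopology G₂]
  [NormedAddCommGroup H₁] [InnerProductSpace ℂ H₁] [CompleteSpace H₁]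
  [NormedAddCommGroup H₂] [InnerProductSpace ℂ H₂] [CompleteSpace H₂]
  {π₁ : ContRepresentation ℂ G₁ H₁} {π₂ : ContRepresentation ℂ G₂ H₂}

/-- **The comparison datum from a matched `*`-algebra of test functions** (Gelbart (1975), §10:
(10.10) from (10.12)–(10.15) and Lemma 10.6; Jacquet–Langlands (1970), §16). Let `π₁`, `π₂` be
unitary strongly continuous representations of second countable groups `G₁`, `G₂` on Hilbert
spaces `H₁`, `H₂`, `η₁`, `η₂` left-invariant inversion-invariant s-finite measures finite on
compact sets (Haar measures of unimodular groups), `σ ≤ π₂` a closed subrepresentation, and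
`φ₁ᵥ : L_v →* G₁`, `φ₂ᵥ : L_v →* G₂` a family of pairs of homomorphisms. Let
`𝒜 ≤ C_c(G₁) × C_c(G₂)` be a `ℂ`-subspace closed under the componentwise involution
`(Φ', Φ) ↦ (Φ'^*, Φ^*)`, componentwise convolution, and componentwise left translation by
`(φ₁ᵥ l, φ₂ᵥ l)`; let `(b_i)`, `(e_l)` be Hilbert bases of `H₁`, `H₂` with
`Σ_l ‖π₂(Φ) e_l‖² ≤ Σ_i ‖π₁(Φ') b_i‖² < ∞` for all `(Φ', Φ) ∈ 𝒜` (the comparison of trace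
formulas in Hilbert–Schmidt form), and suppose `π₂(Φ)|_σ ≠ 0` for some `(Φ', Φ) ∈ 𝒜`. Then
`B = {(π₁(Φ'), π₂(Φ)|_σ) : (Φ', Φ) ∈ 𝒜}` is a `ℂ`-subspace of `𝓑(H₁) × 𝓑(σ)` closed under
products and adjoints and under left multiplication by the pairs `(π₁(φ₁ᵥ l), σ(φ₂ᵥ l))`, with
`Σ_j ‖f₂ c_j‖² ≤ Σ_i ‖f₁ b_i‖² < ∞` for all `(f₁, f₂) ∈ B` and any Hilbert basis `(c_j)` of `σ`,
and containing a pair with `f₂ ≠ 0` — the hypothesis of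
`jacquetLanglands_transfer_surjective_of_hilbertSchmidtComparison` for `σ`.
[cite: Gelbart1975, (10.10)–(10.15) and Lemma 10.6] -/
theorem exists_comparisonDatum_of_testAlgebra
    (hu₁ : π₁.IsUnitary) (hc₁ : π₁.IsStronglyContinuous)
    (hu₂ : π₂.IsUnitary) (hc₂ : π₂.IsStronglyContinuous)
    (η₁ : Measure G₁) [IsFiniteMeasureOnCompacts η₁] [SFinite η₁] [η₁.IsMulLeftInvariant]
    [η₁.IsInvInvariant]
    (η₂ : Measure G₂) [IsFiniteMeasureOnCompacts η₂] [SFinite η₂] [η₂.IsMulLeftInvariant]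
    [η₂.IsInvInvariant]
    (σ : ClosedSubrep π₂)
    {𝓥 : Type*} {L : 𝓥 → Type*} [∀ v, Group (L v)] (φ₁ : ∀ v, L v →* G₁) (φ₂ : ∀ v, L v →* G₂)
    (𝒜 : Submodule ℂ (C_c(G₁, ℂ) × C_c(G₂, ℂ)))
    (hstar : ∀ p ∈ 𝒜, ∃ q ∈ 𝒜, (∀ x, q.1 x = mulStar (⇑p.1) x) ∧ (∀ x, q.2 x = mulStar (⇑p.2) x))
    (hconv : ∀ p ∈ 𝒜, ∀ q ∈ 𝒜, ∃ r ∈ 𝒜, (∀ x, r.1 x = mulConv η₁ (⇑p.1) (⇑q.1) x) ∧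
      (∀ x, r.2 x = mulConv η₂ (⇑p.2) (⇑q.2) x))
    (htrans : ∀ (v : 𝓥) (l : L v), ∀ p ∈ 𝒜, ∃ q ∈ 𝒜, (∀ x, q.1 x = p.1 ((φ₁ v l)⁻¹ * x)) ∧
      (∀ x, q.2 x = p.2 ((φ₂ v l)⁻¹ * x)))
    {ι₁ ι₂ : Type*} (b : HilbertBasis ι₁ ℂ H₁) (e : HilbertBasis ι₂ ℂ H₂)
    (hHS : ∀ p ∈ 𝒜, ∑' l, (‖π₂.integratedOperator hu₂ hc₂ η₂ p.2 (e l)‖₊ : ℝ≥0∞) ^ 2 ≤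
      ∑' i, (‖π₁.integratedOperator hu₁ hc₁ η₁ p.1 (b i)‖₊ : ℝ≥0∞) ^ 2)
    (hfin : ∀ p ∈ 𝒜, ∑' i, (‖π₁.integratedOperator hu₁ hc₁ η₁ p.1 (b i)‖₊ : ℝ≥0∞) ^ 2 < ∞)
    (hne : ∃ p ∈ 𝒜, σ.integratedOperatorRestrict hu₂ hc₂ η₂ p.2 ≠ 0) :
    ∃ (w₂ : Set σ.toSubmodule) (c : HilbertBasis w₂ ℂ σ.toSubmodule)
      (B : Submodule ℂ ((H₁ →L[ℂ] H₁) × (σ.toSubmodule →L[ℂ] σ.toSubmodule))),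
      (∀ f ∈ B, ∀ h ∈ B, f * h ∈ B) ∧ (∀ f ∈ B, star f ∈ B) ∧
      (∀ (v : 𝓥) (l : L v), ∀ f ∈ B,
        ((π₁ (φ₁ v l), σ.toContRep (φ₂ v l)) :
          (H₁ →L[ℂ] H₁) × (σ.toSubmodule →L[ℂ] σ.toSubmodule)) * f ∈ B) ∧
      (∀ f ∈ B, ∑' j, (‖f.2 (c j)‖₊ : ℝ≥0∞) ^ 2 ≤ ∑' i, (‖f.1 (b i)‖₊ : ℝ≥0∞) ^ 2) ∧
      (∀ f ∈ B, ∑' i, (‖f.1 (b i)‖₊ : ℝ≥0∞) ^ 2 < ∞) ∧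
      ∃ f ∈ B, f.2 ≠ 0 := by
  haveI : CompleteSpace σ.toSubmodule := σ.isClosed'.completeSpace_coe
  obtain ⟨w₂, c, -⟩ := exists_hilbertBasis ℂ σ.toSubmodule
  -- the linear map `(Φ', Φ) ↦ (π₁(Φ'), π₂(Φ)|_σ)`
  let Lmap : (C_c(G₁, ℂ) × C_c(G₂, ℂ)) →ₗ[ℂ]
      ((H₁ →L[ℂ] H₁) × (σ.toSubmodule →L[ℂ] σ.toSubmodule)) :=
    { toFun := fun p => (π₁.integratedOperator hu₁ hc₁ η₁ p.1,
        σ.integratedOperatorRestrict hu₂ hc₂ η₂ p.2)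
      map_add' := fun p q => by
        simp only [Prod.fst_add, Prod.snd_add, integratedOperator_add,
          ClosedSubrep.integratedOperatorRestrict_add, Prod.mk_add_mk]
      map_smul' := fun a p => by
        simp only [Prod.smul_fst, Prod.smul_snd, integratedOperator_smul,
          ClosedSubrep.integratedOperatorRestrict_smul, RingHom.id_apply, Prod.smul_mk] }
  have hL : ∀ p, Lmap p = (π₁.integratedOperator hu₁ hc₁ η₁ p.1,
      σ.integratedOperatorRestrict hu₂ hc₂ η₂ p.2) := fun p => rfl
  refine ⟨w₂, c, 𝒜.map Lmap, ?_, ?_, ?_, ?_, ?_, ?_⟩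
  · -- products: convolution
    rintro f ⟨p, hp, rfl⟩ h ⟨q, hq, rfl⟩
    obtain ⟨r, hr, hr1, hr2⟩ := hconv p hp q hq
    refine ⟨r, hr, ?_⟩
    rw [hL, hL, hL, Prod.mk_mul_mk, ContinuousLinearMap.mul_def, ContinuousLinearMap.mul_def,
      integratedOperator_comp_integratedOperator hu₁ hc₁ η₁ p.1 q.1 r.1 hr1,
      ClosedSubrep.integratedOperatorRestrict_comp hu₂ hc₂ η₂ σ p.2 q.2 r.2 hr2]
  · -- adjoints: involution
    rintro f ⟨p, hp, rfl⟩
    obtain ⟨q, hq, hq1, hq2⟩ := hstar p hp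
    refine ⟨q, hq, ?_⟩
    rw [hL, hL, Prod.ext_iff]
    simp only [Prod.fst_star, Prod.snd_star, ContinuousLinearMap.star_eq_adjoint]
    exact ⟨(adjoint_integratedOperator hu₁ hc₁ η₁ p.1 q.1 hq1).symm,
      (ClosedSubrep.adjoint_integratedOperatorRestrict hu₂ hc₂ η₂ σ p.2 q.2 hq2).symm⟩
  · -- left translations
    rintro v l f ⟨p, hp, rfl⟩
    obtain ⟨q, hq, hq1, hq2⟩ := htrans v l p hp
    refine ⟨q, hq, ?_⟩
    rw [hL, hL, Prod.mk_mul_mk, ContinuousLinearMap.mul_def, ContinuousLinearMap.mul_def,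
      apply_comp_integratedOperator hu₁ hc₁ η₁ (φ₁ v l) p.1 q.1 hq1,
      ClosedSubrep.toContRep_comp_integratedOperatorRestrict hu₂ hc₂ η₂ σ (φ₂ v l) p.2 q.2 hq2]
  · -- the Hilbert–Schmidt inequality
    rintro f ⟨p, hp, rfl⟩
    rw [hL]
    exact (ClosedSubrep.tsum_nnnorm_sq_integratedOperatorRestrict_le hu₂ hc₂ η₂ σ c e p.2).trans
      (hHS p hp)
  · -- finiteness
    rintro f ⟨p, hp, rfl⟩
    rw [hL]
    exact hfin p hp
  · -- non-vanishing
    obtain ⟨p, hp, hp0⟩ := hne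
    exact ⟨Lmap p, ⟨p, hp, rfl⟩, hp0⟩

end Datum

end Literature.NumberTheory.Automorphic
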